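import Mathlib

/-!
# P7Dim8H1H2Counts — the 0/1-matrix core of P7-H1H2CMReadingCheck §2 (Props 2.9–2.10): the counts behind the
D₄-quadruple rows (b), (c) = (h1), (d) = (h2) and (a) of the (2,2,2,2) census (P5-Dim8Census-v3.3 Theorem 2.1 (continued,
PART 2b), Theorem 3.1b (ii))

Kernel-checked enumeration (README §2 / R-5: finite arithmetic by `decide`, never the discharge of a Hodge-theoretic step).
Setting (note §2, Lemma 2.4): on the unique order-8 group `T ≅ D₄ = ⟨f, g⟩` (`u = fg`, `u² = ι` central) of a class
`{3, 6, 8}`, the type function `χ_s : T → F₂`, `χ_s(t) = [ts ∉ Φ]`, of a point `s` is recorded on the transversal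
`(1, f, g, u)` of `T/⟨ι⟩` as a 0/1-vector of length 4; the points of the two «g-blocks» carry the EVEN vectors
(stabiliser `⟨g⟩`: `(a,b,a,b)`; `⟨gι⟩`: `(a,b,ā,b̄)`), the points of the two «f-blocks» the ODD vectors
(`⟨f⟩`: `(a,a,d,d̄)`; `⟨fι⟩`: `(a,ā,d,d)`); the right translations `χ·f`, `χ·g`, `χ·u` and the complement `χ·ι` are
`rf`, `rg`, `ru`, `compl` below; the two points of a doubled f-block carry `(χ, χ')` with `χ' ∈ {χ·g, 1 + χ·g}`.
A set `Δ` is balanced iff the integer sum of its vectors is `(p,…,p)`, primitive iff no two of its vectors are complementary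
(for `|Δ| ≤ 6`), and `H_Δ` (Def 10.8) is the set of right translations preserving the multiset of its vectors.

Certified: (i) exactly 96 primitive balanced quadruples `(χ_i, χ_j | χ_k, χ_l)` (two even, two odd), of which 32 have
`H_Δ = 1` (the row (c) = (h1): `16·32/(8·8) = 8` pairs per class) and 64 have `|H_Δ| = 2` (the row (b): 16 per class); in the
96, «T_{s_i} = T_{s_j}», «T_{s_k} = T_{s_l}» and «neither» each occur 32 times, the last being exactly the `H_Δ = 1` ones;
(ii) exactly 16 primitive balanced sextuples of profile (1,1,2,2) (doubled f-blocks), all with `χ_i = χ_j` (the two single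
blocks copies of one factor) and `|H_Δ| = 2` (`16·16/(8·4) = 8` pairs per class and profile, 16 per class: the row (d) = (h2));
(iii) exactly 16 primitive balanced quadruples of profile (2,1,1,0) (one f-block doubled, two g-blocks single), all with
`T_{s_i} = T_{s_j}` and `|H_Δ| = 2` (the row (a): one orbit per configuration with non-isogenous single blocks).
-/

namespace HodgeRepro0.P7Dim8H1H2Counts

/-- the 16 vectors of `F₂⁴` as 0/1-lists `[χ(1), χ(f), χ(g), χ(u)]`. -/
def V : List (List ℕ) :=
  [0, 1].flatMap fun a => [0, 1].flatMap fun b => [0, 1].flatMap fun c => [0, 1].map fun d => [a, b, c, d]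

/-- even weight: the vectors of the g-blocks. -/
def isEven (x : List ℕ) : Bool := x.sum % 2 == 0

/-- the complement `χ·ι`. -/
def compl (x : List ℕ) : List ℕ := x.map fun c => 1 - c

/-- the right translation `χ·f = (χ_f, χ_1, χ_u + 1, χ_g + 1)`. -/
def rf : List ℕ → List ℕ
  | [a, b, c, d] => [b, a, 1 - d, 1 - c]
  | x => x

/-- the right translation `χ·g = (χ_g, χ_u, χ_1, χ_f)`. -/
def rg : List ℕ → List ℕ
  | [a, b, c, d] => [c, d, a, b]
  | x => x

/-- the right translation `χ·u = (χ_u, χ_g, χ_f + 1, χ_1 + 1)`. -/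
def ru : List ℕ → List ℕ
  | [a, b, c, d] => [d, c, 1 - b, 1 - a]
  | x => x

/-- stabiliser `⟨f⟩`: `(a, a, d, d̄)`. -/
def isF (x : List ℕ) : Bool := match x with | [a, b, c, d] => a == b && c + d == 1 | _ => false
/-- stabiliser `⟨fι⟩`: `(a, ā, d, d)`. -/
def isFi (x : List ℕ) : Bool := match x with | [a, b, c, d] => a + b == 1 && c == d | _ => false
/-- stabiliser `⟨g⟩`: `(a, b, a, b)`. -/
def isG (x : List ℕ) : Bool := match x with | [a, b, c, d] => a == c && b == d | _ => false
/-- stabiliser `⟨gι⟩`: `(a, b, ā, b̄)`. -/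
def isGi (x : List ℕ) : Bool := match x with | [a, b, c, d] => a + c == 1 && b + d == 1 | _ => false

/-- the integer sum of a list of vectors. -/
def isum (l : List (List ℕ)) : List ℕ := l.foldr (fun x acc => List.zipWith (· + ·) x acc) [0, 0, 0, 0]

/-- primitive: no two vectors of the list complementary. -/
def noCompl (l : List (List ℕ)) : Bool := l.all fun x => !(l.contains (compl x))

/-- multiset equality of two lists of vectors (by counts). -/
def msEq (l m : List (List ℕ)) : Bool := l.length == m.length && l.all fun x => l.count x == m.count x

/-- the non-trivial right translations preserving the multiset: `H_Δ ∖ {1}` (as names). -/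
def hstab (l : List (List ℕ)) : List String :=
  [("f", rf), ("fi", fun x => compl (rf x)), ("g", rg), ("gi", fun x => compl (rg x)),
   ("u", ru), ("ui", fun x => compl (ru x)), ("i", compl)].filterMap fun p =>
    if msEq (l.map p.2) l then some p.1 else none

/-- the eight even vectors (the points of the g-blocks). -/
def evens : List (List ℕ) := V.filter isEven
/-- the eight odd vectors (the points of the f-blocks). -/
def odds : List (List ℕ) := V.filter fun x => !isEven x

/-- the fourth vector of a balanced quadruple with integer sum `(2,2,2,2)`, if it is a 0/1-vector. -/
def fourth (x y z : List ℕ) : Option (List ℕ) :=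
  let w := List.zipWith (fun s t => s - t) [2, 2, 2, 2] (isum [x, y, z])
  if (isum [x, y, z]).all (fun s => 1 ≤ s && s ≤ 2) then some w else none

/-- the primitive balanced quadruples `(χ_i, χ_j, χ_k, χ_l)`: `χ_i, χ_j` even, `χ_k, χ_l` odd, sum `(2,2,2,2)`, no
complementary pair (the H-partition [1,1,1,1], profile (1,1,1,1)). -/
def quads : List (List (List ℕ)) :=
  evens.flatMap fun x => evens.flatMap fun y => odds.filterMap fun z =>
    match fourth x y z with
    | some w => if !isEven w && noCompl [x, y, z, w] then some [x, y, z, w] else none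
    | none => none

/-- (i): 96 quadruples; 32 with `H_Δ = 1`, 64 with `|H_Δ| = 2`; the three stabiliser patterns 32 / 32 / 32, the third = `H_Δ = 1`. -/
theorem quads_counts :
    quads.length = 96 ∧
    (quads.filter fun q => (hstab q).length == 0).length = 32 ∧
    (quads.filter fun q => (hstab q).length == 1).length = 64 ∧
    (quads.filter fun q => match q with
      | [x, y, _, _] => (isG x && isG y) || (isGi x && isGi y)
      | _ => false).length = 32 ∧
    (quads.filter fun q => match q with
      | [_, _, z, w] => (isF z && isF w) || (isFi z && isFi w)
      | _ => false).length = 32 ∧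
    (quads.filter fun q => match q with
      | [x, y, z, w] => !((isG x && isG y) || (isGi x && isGi y)) && !((isF z && isF w) || (isFi z && isFi w))
      | _ => false) = (quads.filter fun q => (hstab q).length == 0) := by
  decide

/-- the two completions of a doubled f-block: `(χ, χ·g)` and `(χ, 1 + χ·g)`. -/
def doubledF : List (List (List ℕ)) :=
  (V.filter isF).flatMap fun z => [[z, rg z], [z, compl (rg z)]]

/-- the primitive balanced sextuples of profile (1,1,2,2): `χ_i` even, the doubled f-blocks `(χ_k, χ_k')`, `(χ_l, χ_l')`,
`χ_j` determined by the sum `(3,3,3,3)`, even, no complementary pair. -/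
def sext : List (List (List ℕ)) :=
  doubledF.flatMap fun zk => doubledF.flatMap fun zl => evens.filterMap fun x =>
    let s := isum (x :: zk ++ zl)
    if s.all (fun t => 2 ≤ t && t ≤ 3) then
      let y := List.zipWith (fun a b => a - b) [3, 3, 3, 3] s
      if isEven y && noCompl (x :: y :: zk ++ zl) then some (x :: y :: zk ++ zl) else none
    else none

/-- (ii): 16 sextuples, all with `χ_i = χ_j`, all with `|H_Δ| = 2` (`g` or `gι`). -/
theorem sext_counts :
    sext.length = 16 ∧
    (sext.all fun l => match l with | x :: y :: _ => x == y | _ => false) = true ∧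
    (sext.all fun l => hstab l == ["g"] || hstab l == ["gi"]) = true := by
  decide

/-- the primitive balanced quadruples of profile (2,1,1,0): one f-block doubled, the g-blocks `χ_i`, `χ_j` single. -/
def quadA : List (List (List ℕ)) :=
  doubledF.flatMap fun zk => evens.filterMap fun x =>
    let s := isum (x :: zk)
    if s.all (fun t => 1 ≤ t && t ≤ 2) then
      let y := List.zipWith (fun a b => a - b) [2, 2, 2, 2] s
      if isEven y && noCompl (x :: y :: zk) then some (x :: y :: zk) else none
    else none

/-- (iii): 16 data of the row (a), all with `T_{s_i} = T_{s_j}` and `|H_Δ| = 2`. -/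
theorem quadA_counts :
    quadA.length = 16 ∧
    (quadA.all fun l => match l with | x :: y :: _ => (isG x && isG y) || (isGi x && isGi y) | _ => false) = true ∧
    (quadA.all fun l => hstab l == ["g"] || hstab l == ["gi"]) = true := by
  decide

/-- the bookkeeping of Lemma 2.4: the eight even vectors are exactly the `⟨g⟩`- and `⟨gι⟩`-forms, the eight odd ones the
`⟨f⟩`- and `⟨fι⟩`-forms, and the right translations fix exactly the vectors of their own stabiliser form. -/
theorem forms :
    (V.filter isEven).length = 8 ∧ (V.filter isF).length = 4 ∧ (V.filter isFi).length = 4 ∧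
    (V.filter isG).length = 4 ∧ (V.filter isGi).length = 4 ∧
    (V.all fun x => (rf x == x) == isF x) = true ∧ (V.all fun x => (compl (rf x) == x) == isFi x) = true ∧
    (V.all fun x => (rg x == x) == isG x) = true ∧ (V.all fun x => (compl (rg x) == x) == isGi x) = true ∧
    (V.all fun x => isEven x == (isG x || isGi x)) = true := by
  decide

end HodgeRepro0.P7Dim8H1H2Counts
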